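import Literature.AlgebraicGeometry.AbelianSchemes.AbelianVarietyCechInversionH2
import Literature.AlgebraicGeometry.Morphisms.CechModuleH2RefinementInjective
import Literature.AlgebraicGeometry.Morphisms.CechModuleH2ScalingVanishing
import HarnessLib

/-!
# An `[−1]`-ANTISYMMETRIC class of `Ȟ²(𝒪)` on an abelian variety vanishes when `2` is a unit
# (Oort 1971, proof of Thm. (2.2.1), pp. 279–280; Mumford AV §13 Cor. 2)

Layer `Literature/AlgebraicGeometry/AbelianSchemes`; namespace `Literature.AlgebraicGeometry.AbelianSchemes.AbelianSchemeOver`.  PROOF file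
(theorems only; no definition, no instance, no notation, no named fact, no `sorry`).  The closing COHOMOLOGY step of [Oort1971]'s first proof of
(2.2.1) («the obstruction is `[−1]`-invariant, `[−1]` acts by `−1`, so `2·o = 0`, hence `o = 0` when `char ≠ 2`»), packaged per frame coordinate:

* `cechMH2_mk_eq_zero_of_refine_comap_inv_eq_neg_of_surjective` ∕ `…_of_finrank_cechH1` ∕ `…` (`[CharZero]`) — for an abelian scheme `B`
  over a field `k` with `IsUnit (2 : k)`, an AFFINE open cover `𝓤`, a raw `2`-cocycle `z` of `𝒪_B`, affine opens `W_s ⊆ U_{τ s} ∩ ι⁻¹U_{τ′ s}`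
  COVERING every `U_i`, and the ANTISYMMETRY `[ρ_{τ′}(ι^* z)] = −[ρ_τ z]` in `Ȟ²(𝓦, 𝒪_B)`: **`[z] = 0` in `Ȟ²(𝓤, 𝒪_B)`** —
  ★ (O4) `cechMH2_mk_refine_comap_inv_of_surjective` (`[ρ_{τ′}(ι^* z)] = [ρ_τ z]`) + ★ `CechMH2.mk_eq_zero_of_scaling_relations` at `n := −1`
  (`(−1)² − (−1) = 2` a unit) + refinement injectivity ★ `CechMH2.mk_eq_zero_of_refineMC2_mem_cechMB2_of_isAffineOpen`.

Cell `hodgecm-mathlib` (D-0151), FLOOR 0 ∕ P6 (U)-road, optional brick (O4c) for the (U-ab) assembler (O6); generic, count-neutral — HC_CM is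
proved only modulo the 7 printed citations until rung 0 closes, and nothing here refers to it.

## References
* F. Oort, *Finite group schemes, local moduli for abelian varieties, and lifting problems*, Compositio Math. 23 (1971), proof of Thm. (2.2.1),
  pp. 279–280. [Oort1971]
* D. Mumford, *Abelian Varieties* (1970), §13 Cor. 2 (p. 129). [MumfordAV1970]
* U. Görtz, T. Wedhorn, *Algebraic Geometry II* (2023), Cor. 21.81 (p. 185), Thm. 22.9 (p. 236). [GortzWedhorn2023]
-/

noncomputable section

open CategoryTheory CategoryTheory.Limits AlgebraicGeometry TopologicalSpace Opposite
open Literature.AlgebraicGeometry.Morphisms Literature.AlgebraicGeometry.Modules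

set_option backward.isDefEq.respectTransparency false

namespace Literature.AlgebraicGeometry.AbelianSchemes.AbelianSchemeOver

variable {k : Type} [Field k] (B : AbelianSchemeOver (Spec (.of k)))
  {ι : Type} (U : ι → B.X.left.affineOpens) (hU : ⨆ j, (U j).1 = ⊤)
  (z : cechMZ2 B.X.hom (SheafOfModules.unit B.X.left.ringCatSheaf) (fun j => (U j).1))
  {κ : Type} (W : κ → B.X.left.affineOpens) (τ τ' : κ → ι)
  (hτ : ∀ s, (W s).1 ≤ (U (τ s)).1) (hτ' : ∀ s, (W s).1 ≤ (AbelianVarietyCech.inv B) ⁻¹ᵁ (U (τ' s)).1)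
  (hUW : ∀ j, (U j).1 ≤ ⨆ s, (W s).1)

include hU hUW in
/-- **`[−1]`-antisymmetric classes vanish (cup-surjectivity as hypothesis).**  If `2 ∈ k^×`, `Ȟ¹ ∪ Ȟ¹ = Ȟ²` on the finite affine
subcovers of `𝓤`, the affine `W_s ⊆ U_{τ s} ∩ ι⁻¹U_{τ′ s}` cover every `U_i`, and `[ρ_{τ′}(ι^* z)] = −[ρ_τ z]`, then `[z] = 0`.
[cite: Oort1971, proof of Thm. (2.2.1), pp. 279–280] [cite: MumfordAV1970, §13 Cor. 2 (p. 129)] [cite: GortzWedhorn2023, Thm. 22.9 (p. 236)] -/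
theorem cechMH2_mk_eq_zero_of_refine_comap_inv_eq_neg_of_surjective (h2 : IsUnit (2 : k))
    (hsurj : ∀ (m : ℕ) (e : Fin m → ι), (⨆ i, (U (e i)).1) = ⊤ →
      Function.Surjective (TensorProduct.lift (AbelianVarietyCech.cupA B (fun i => U (e i)) 1 1 2 rfl)))
    (hneg : CechMH2.mk B.X.hom (SheafOfModules.unit B.X.left.ringCatSheaf) (fun s => (W s).1)
        ⟨cechMRefineC2 B.X.hom (SheafOfModules.unit B.X.left.ringCatSheaf)
            (preimageFamily (AbelianVarietyCech.inv B) (fun j => (U j).1)) (fun s => (W s).1) τ' hτ'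
            (cechComapC2 B.X.hom B.X.hom (AbelianVarietyCech.inv B) (Over.w (GrpObj.inv : B.X ⟶ B.X)) (fun j => (U j).1)
              (z : CechMC2 B.X.hom (SheafOfModules.unit B.X.left.ringCatSheaf) (fun j => (U j).1))),
          refineMC2_mem_cechMZ2 B.X.hom (SheafOfModules.unit B.X.left.ringCatSheaf)
            (preimageFamily (AbelianVarietyCech.inv B) (fun j => (U j).1)) (fun s => (W s).1) τ' hτ'
            (comapC2_mem_cechMZ2 B.X.hom B.X.hom (AbelianVarietyCech.inv B) (Over.w (GrpObj.inv : B.X ⟶ B.X))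
              (fun j => (U j).1) z.2)⟩ =
      -CechMH2.mk B.X.hom (SheafOfModules.unit B.X.left.ringCatSheaf) (fun s => (W s).1)
        ⟨cechMRefineC2 B.X.hom (SheafOfModules.unit B.X.left.ringCatSheaf) (fun j => (U j).1) (fun s => (W s).1) τ hτ
            (z : CechMC2 B.X.hom (SheafOfModules.unit B.X.left.ringCatSheaf) (fun j => (U j).1)),
          refineMC2_mem_cechMZ2 B.X.hom (SheafOfModules.unit B.X.left.ringCatSheaf) (fun j => (U j).1) (fun s => (W s).1) τ hτ
            z.2⟩) :
    CechMH2.mk B.X.hom (SheafOfModules.unit B.X.left.ringCatSheaf) (fun j => (U j).1) z = 0 := by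
  -- the refined class vanishes: eigenvalue clash `(−1)² − (−1) = 2 ∈ k^×`
  have hW0 : CechMH2.mk B.X.hom (SheafOfModules.unit B.X.left.ringCatSheaf) (fun s => (W s).1)
      ⟨cechMRefineC2 B.X.hom (SheafOfModules.unit B.X.left.ringCatSheaf) (fun j => (U j).1) (fun s => (W s).1) τ hτ
          (z : CechMC2 B.X.hom (SheafOfModules.unit B.X.left.ringCatSheaf) (fun j => (U j).1)),
        refineMC2_mem_cechMZ2 B.X.hom (SheafOfModules.unit B.X.left.ringCatSheaf) (fun j => (U j).1) (fun s => (W s).1) τ hτ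
          z.2⟩ = 0 := by
    refine CechMH2.mk_eq_zero_of_scaling_relations B.X.hom (SheafOfModules.unit B.X.left.ringCatSheaf) (fun j => (U j).1)
      (fun s => (W s).1) τ hτ z.2 _ _ (-1 : k) (by rw [neg_mul_neg, one_mul, sub_neg_eq_add, one_add_one_eq_two]; exact h2)
      (by rw [hneg, neg_one_smul]) rfl ?_
    rw [neg_mul_neg, one_mul, one_smul]
    exact cechMH2_mk_refine_comap_inv_of_surjective B U hU hsurj z W τ τ' hτ hτ'
  -- injectivity of the refinement on the affine cover `𝓤`
  exact CechMH2.mk_eq_zero_of_refineMC2_mem_cechMB2_of_isAffineOpen B.X.hom (SheafOfModules.unit B.X.left.ringCatSheaf)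
    (fun j => (U j).1) (fun s => (W s).1) τ hτ IsAffineLocalizing.unit (fun j => (U j).2) hUW z
    ((CechMH2.mk_eq_zero_iff _ _ _ _).mp hW0)

include hU hUW in
/-- **`[−1]`-antisymmetric classes vanish, ANY characteristic with `2 ∈ k^×`, from the `H¹`-count** (cup-surjectivity per finite affine
subcover by ★ (G4) `cup_one_one_surjective_of_dim_le_finrank_cechH1`). [cite: Oort1971, proof of Thm. (2.2.1), pp. 279–280]
[cite: MumfordAV1970, §13 Cor. 2 (p. 129)] -/
theorem cechMH2_mk_eq_zero_of_refine_comap_inv_eq_neg_of_finrank_cechH1 (h2 : IsUnit (2 : k))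
    (hH1 : ∀ {J : Type} [Finite J] (V : J → B.X.left.Opens), (∀ j, IsAffineOpen (V j)) → iSup V = ⊤ →
      B.toAffine.toAbelianVariety.dim ≤ Module.finrank k (CechH1 B.X.hom V) + 1)
    (hneg : CechMH2.mk B.X.hom (SheafOfModules.unit B.X.left.ringCatSheaf) (fun s => (W s).1)
        ⟨cechMRefineC2 B.X.hom (SheafOfModules.unit B.X.left.ringCatSheaf)
            (preimageFamily (AbelianVarietyCech.inv B) (fun j => (U j).1)) (fun s => (W s).1) τ' hτ'
            (cechComapC2 B.X.hom B.X.hom (AbelianVarietyCech.inv B) (Over.w (GrpObj.inv : B.X ⟶ B.X)) (fun j => (U j).1)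
              (z : CechMC2 B.X.hom (SheafOfModules.unit B.X.left.ringCatSheaf) (fun j => (U j).1))),
          refineMC2_mem_cechMZ2 B.X.hom (SheafOfModules.unit B.X.left.ringCatSheaf)
            (preimageFamily (AbelianVarietyCech.inv B) (fun j => (U j).1)) (fun s => (W s).1) τ' hτ'
            (comapC2_mem_cechMZ2 B.X.hom B.X.hom (AbelianVarietyCech.inv B) (Over.w (GrpObj.inv : B.X ⟶ B.X))
              (fun j => (U j).1) z.2)⟩ =
      -CechMH2.mk B.X.hom (SheafOfModules.unit B.X.left.ringCatSheaf) (fun s => (W s).1)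
        ⟨cechMRefineC2 B.X.hom (SheafOfModules.unit B.X.left.ringCatSheaf) (fun j => (U j).1) (fun s => (W s).1) τ hτ
            (z : CechMC2 B.X.hom (SheafOfModules.unit B.X.left.ringCatSheaf) (fun j => (U j).1)),
          refineMC2_mem_cechMZ2 B.X.hom (SheafOfModules.unit B.X.left.ringCatSheaf) (fun j => (U j).1) (fun s => (W s).1) τ hτ
            z.2⟩) :
    CechMH2.mk B.X.hom (SheafOfModules.unit B.X.left.ringCatSheaf) (fun j => (U j).1) z = 0 :=
  cechMH2_mk_eq_zero_of_refine_comap_inv_eq_neg_of_surjective B U hU z W τ τ' hτ hτ' hUW h2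
    (fun _ e he => AbelianVarietyCech.cup_one_one_surjective_of_dim_le_finrank_cechH1 B (fun i => U (e i)) he
      (hH1 (fun i => (U (e i)).1) (fun i => (U (e i)).2) he))
    hneg

include hU hUW in
/-- **`[−1]`-antisymmetric classes vanish in characteristic `0`** (cup-surjectivity by ★ `cup_one_one_surjective`; `2 ≠ 0`).
[cite: Oort1971, proof of Thm. (2.2.1), pp. 279–280] [cite: MumfordAV1970, §13 Cor. 2 (p. 129)] -/
theorem cechMH2_mk_eq_zero_of_refine_comap_inv_eq_neg [CharZero k]
    (hneg : CechMH2.mk B.X.hom (SheafOfModules.unit B.X.left.ringCatSheaf) (fun s => (W s).1)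
        ⟨cechMRefineC2 B.X.hom (SheafOfModules.unit B.X.left.ringCatSheaf)
            (preimageFamily (AbelianVarietyCech.inv B) (fun j => (U j).1)) (fun s => (W s).1) τ' hτ'
            (cechComapC2 B.X.hom B.X.hom (AbelianVarietyCech.inv B) (Over.w (GrpObj.inv : B.X ⟶ B.X)) (fun j => (U j).1)
              (z : CechMC2 B.X.hom (SheafOfModules.unit B.X.left.ringCatSheaf) (fun j => (U j).1))),
          refineMC2_mem_cechMZ2 B.X.hom (SheafOfModules.unit B.X.left.ringCatSheaf)
            (preimageFamily (AbelianVarietyCech.inv B) (fun j => (U j).1)) (fun s => (W s).1) τ' hτ'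
            (comapC2_mem_cechMZ2 B.X.hom B.X.hom (AbelianVarietyCech.inv B) (Over.w (GrpObj.inv : B.X ⟶ B.X))
              (fun j => (U j).1) z.2)⟩ =
      -CechMH2.mk B.X.hom (SheafOfModules.unit B.X.left.ringCatSheaf) (fun s => (W s).1)
        ⟨cechMRefineC2 B.X.hom (SheafOfModules.unit B.X.left.ringCatSheaf) (fun j => (U j).1) (fun s => (W s).1) τ hτ
            (z : CechMC2 B.X.hom (SheafOfModules.unit B.X.left.ringCatSheaf) (fun j => (U j).1)),
          refineMC2_mem_cechMZ2 B.X.hom (SheafOfModules.unit B.X.left.ringCatSheaf) (fun j => (U j).1) (fun s => (W s).1) τ hτ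
            z.2⟩) :
    CechMH2.mk B.X.hom (SheafOfModules.unit B.X.left.ringCatSheaf) (fun j => (U j).1) z = 0 :=
  cechMH2_mk_eq_zero_of_refine_comap_inv_eq_neg_of_surjective B U hU z W τ τ' hτ hτ' hUW
    (isUnit_iff_ne_zero.mpr two_ne_zero)
    (fun _ e he => AbelianVarietyCech.cup_one_one_surjective B (fun i => U (e i)) he) hneg

end Literature.AlgebraicGeometry.AbelianSchemes.AbelianSchemeOver

end
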